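import Mathlib
import HarnessLib
import Summits.AtomisticToContinuum.FouriersLaw.Theses.JunctionLocality
import Summits.AtomisticToContinuum.FouriersLaw.Theorems.JunctionLocalitySuperadditiveResistanceDeviceLiouville
import Summits.AtomisticToContinuum.FouriersLaw.Theorems.JunctionLocalitySuperadditiveResistancePlainAdjoint
import Summits.AtomisticToContinuum.FouriersLaw.Theorems.JunctionLocalitySuperadditiveResistanceStubDeviceForwardFieldsAux1
import Summits.AtomisticToContinuum.FouriersLaw.Theorems.JunctionLocalitySuperadditiveResistanceStubDeviceForwardFieldsAux2
import Literature.Analysis.Hypoelliptic.HormanderProof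

/-!
# Forward fields of the γ-probed device, III: weak `L¹(μ_T)` solutions are classical
(helper toward stub `stub_deviceForwardFields` of line `floating-probe-bypass-laplacian`,
crux stmt-AtomisticToContinuum-11748; Part III of six, see Part I `…StubDeviceForwardFieldsAux1`
for the overview)

For `pinnedChain ω₂ lam β γ`, `L ≥ 1` sites, site weights `B ≥ 0` with `B_0 > 0`, `σ ≠ 0`,
`c > 0`, `T > 0`:
* `exists_smooth_ae_eq_of_weak_gen` — HYPOELLIPTIC REGULARITY (Lebesgue form): a locally
  integrable `F` with `∫ (−σ X_H φ + c S_B φ + κ φ) F dx = ∫ r φ dx` for all test `φ` (`r` smooth,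
  `κ` constant) is a.e. a smooth function: Hörmander's Theorem 1.1 (`hormander1967_thm11_proof`, PROVED in the
  tree) for the operator of Part I (`hormanderTranspose_gen`) with the brackets of Part II;
* `exists_classical_of_weak_gibbs` — the `μ_T` form: `g ∈ L¹(μ_T)` with
  `∫ (−σ X_H φ + c S_B φ + κ φ) g dμ_T = ∫ f φ dμ_T` (`φ ∈ C_c^∞`, `f` smooth) agrees `μ_T`-a.e.
  with a smooth `g′` solving `σ X_H g′ + c S_B g′ + κ g′ = f` POINTWISE (Part II's adjointness and
  the fundamental lemma of the calculus of variations; `κ = 0` Poisson, `κ = −λ` resolvent);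
* `deviceForwardField_of_weak` — the device (`σ = 1`, `c = γ`, `B = deviceWeight N M`,
  `f = −(p_s² − T)`): a mean-zero weak `L²(μ_T)` solution is a.e. a classical forward field
  (the four clauses of the line's `deviceForwardFields … s`); `plainForwardField_of_weak` — the
  same for the plain chain (`B = bathWeight`, `generator L T T`; clauses of `plainForwardFields`).

So `stub_deviceForwardFields` is reduced EXACTLY to the existence, for each terminal site, of a
mean-zero weak solution in `L²(μ_T)` — the quantitative-ergodicity input (Cuneo–Eckmann–Hairer–
Rey-Bellet 2018 Thm 2.13 (3) for the four-thermostat network, or an `L²(μ_T)` spectral statement)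
that the tree does not have for the device; Parts IV–VI construct the resolvent fields
`(λ − L_dev)⁻¹(p_s² − T)` for every `λ > 0`, so what is missing is a `λ`-uniform `L²` bound. Mechanism: Eckmann–Pillet–Rey-Bellet CMP 201 (1999)
§3; CEHR 2018 Prop. 3.2/4.1. Axioms: `propext`, `Classical.choice`, `Quot.sound`.
-/

noncomputable section

open MeasureTheory Filter Topology
open scoped ContDiff
open Literature.MathematicalPhysics.KineticTheory.HeatConduction
open Summit.AtomisticToContinuum.FouriersLaw.Theorems.SuperadditiveResistance.DeviceLiouville

namespace Summit.AtomisticToContinuum.FouriersLaw.Cruxes.SuperadditiveResistance.FloatingProbeBypassLaplacian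

open Literature.Analysis.Distribution

variable {L : ℕ}

/-! Terms (no definitions), as in Parts I–II: `X₀ = fun x => σ • hamField P L x + c • (0, B * x.2)`,
`X = fun i _ => √(cTB_i) • unitP i`. -/

/-! ## Hypoelliptic regularity of weak solutions of `(σ X_H + c S_B) g = f` -/

section Regularity

open Distributions

variable {ω₂ lam β : ℝ}

/-- **Hypoelliptic regularity, Lebesgue form.** For the pinned chain (`β ≥ 0`, so
`V″ = 1 + 3βr² ≠ 0`; `U, V` smooth), `L ≥ 1`, `σ ≠ 0`, site weights with `c T B_i ≥ 0` and
`c T B_0 > 0`, constant `κ`: a locally integrable `F` with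
`∫ (−σ X_H φ + c S_B φ + κ φ) F dx = ∫ r φ dx` for all test `φ` and a smooth `r` agrees a.e. with
a smooth function — Hörmander's Theorem 1.1 (PROVED in the tree, `hormander1967_thm11_proof`) for
the operator `Σ_i X_i² + X₀ + (cΣB + κ)` of the family `(X₀; X_i)` of Part I, whose formal
transpose is
`−σ X_H + c S_B + κ` (`hormanderTranspose_gen`) and which is bracket generating
(`isBracketGenerating_genFamily`). (adapted from `exists_smooth_ae_eq_of_weak`) [folklore] -/
theorem exists_smooth_ae_eq_of_weak_gen (hβ : 0 ≤ β) (γ : ℝ) {L : ℕ} (hL : 0 < L) {σ c T : ℝ}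
    (hσ : σ ≠ 0) {B : Fin L → ℝ} (hB : ∀ i, 0 ≤ c * T * B i) (hB0 : 0 < c * T * B ⟨0, hL⟩)
    (κ : ℝ) {F : PhaseSpace L → ℝ} (hF : LocallyIntegrable F volume) {r : PhaseSpace L → ℝ}
    (hr : ContDiff ℝ ∞ r)
    (hweak : ∀ φ : PhaseSpace L → ℝ, ContDiff ℝ ∞ φ → HasCompactSupport φ →
      ∫ x, (-σ * liouvilleOp (pinnedChain ω₂ lam β γ) L φ x + c * bathOp L B T φ x + κ * φ x) *
        F x = ∫ x, r x * φ x) :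
    ∃ g : PhaseSpace L → ℝ, ContDiff ℝ ∞ g ∧ F =ᵐ[volume] g := by
  haveI := isAddHaarMeasure_volume_phaseSpace L
  set P := pinnedChain ω₂ lam β γ with hP
  have hU : ContDiff ℝ ∞ P.U := pinnedChain_contDiff_U ω₂ lam β γ
  have hV : ContDiff ℝ ∞ P.V := pinnedChain_contDiff_V ω₂ lam β γ
  have hV2 : ∀ r, deriv (deriv P.V) r ≠ 0 := fun r => by
    rw [hP, pinnedChain_deriv_deriv_V]; positivity
  have hFloc : LocallyIntegrableOn F
      ((⊤ : TopologicalSpace.Opens (PhaseSpace L)) : Set (PhaseSpace L)) volume :=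
    hF.locallyIntegrableOn _
  let u : 𝓓'((⊤ : TopologicalSpace.Opens (PhaseSpace L)), ℝ) :=
    (TestFunction.integralAgainstBilinCLM (ContinuousLinearMap.mul ℝ ℝ) volume F :
      𝓓((⊤ : TopologicalSpace.Opens (PhaseSpace L)), ℝ) →L[ℝ] ℝ)
  have hu : ∀ φ : 𝓓((⊤ : TopologicalSpace.Opens (PhaseSpace L)), ℝ), u φ = ∫ x, φ x * F x := by
    intro φ
    change TestFunction.integralAgainstBilinCLM (ContinuousLinearMap.mul ℝ ℝ) volume F φ = _
    rw [TestFunction.integralAgainstBilinCLM_eq_integral hFloc]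
    simp
  have hyp := Literature.Analysis.Hypoelliptic.hormander1967_thm11_proof (PhaseSpace L) volume
    (Fin L) ⊤ ((fun x : PhaseSpace L => σ • hamField P L x + c • (((0 : Fin L → ℝ), B * Prod.snd x) : PhaseSpace L))) ((fun (i : Fin L) (_x : PhaseSpace L) => Real.sqrt (c * T * B i) • (unitP i : PhaseSpace L))) (fun _ => c * (∑ i, B i) + κ)
    (contDiff_genDrift hU hV L σ c B) (fun i => contDiff_genField L c T B i) contDiff_const
    (isBracketGenerating_genFamily hL σ c T B hU hV hσ hB0 hV2)
  have himg : ImageIsSmoothOn u (hormanderTranspose ((fun x : PhaseSpace L => σ • hamField P L x + c • (((0 : Fin L → ℝ), B * Prod.snd x) : PhaseSpace L))) ((fun (i : Fin L) (_x : PhaseSpace L) => Real.sqrt (c * T * B i) • (unitP i : PhaseSpace L)))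
      (fun _ => c * (∑ i, B i) + κ)) volume Set.univ := by
    refine ⟨r, hr.contDiffOn, fun φ ψ _ hψ => ?_⟩
    rw [hu]
    have h1 : (fun x => ψ x) = hormanderTranspose ((fun x : PhaseSpace L => σ • hamField P L x + c • (((0 : Fin L → ℝ), B * Prod.snd x) : PhaseSpace L))) ((fun (i : Fin L) (_x : PhaseSpace L) => Real.sqrt (c * T * B i) • (unitP i : PhaseSpace L)))
        (fun _ => c * (∑ i, B i) + κ) φ := hψ
    have h2 := hweak φ φ.contDiff φ.hasCompactSupport
    have h3 : (fun x => hormanderTranspose ((fun x : PhaseSpace L => σ • hamField P L x + c • (((0 : Fin L → ℝ), B * Prod.snd x) : PhaseSpace L))) ((fun (i : Fin L) (_x : PhaseSpace L) => Real.sqrt (c * T * B i) • (unitP i : PhaseSpace L)))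
        (fun _ => c * (∑ i, B i) + κ) φ x * F x) =
        fun x => (-σ * liouvilleOp P L φ x + c * bathOp L B T φ x + κ * φ x) * F x :=
      funext fun x => by rw [hormanderTranspose_gen hU hV L σ hB κ φ.contDiff]
    rw [show (∫ x, ψ x * F x) = ∫ x, (fun x => ψ x) x * F x from rfl, h1, h3]
    exact h2
  obtain ⟨g, hg, hgint⟩ := hyp u Set.univ isOpen_univ (Set.subset_univ _) himg
  refine ⟨g, contDiffOn_univ.mp hg, ?_⟩
  have hgloc : LocallyIntegrable g volume := (contDiffOn_univ.mp hg).continuous.locallyIntegrable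
  refine ae_eq_of_integral_contDiff_smul_eq hF hgloc fun φ hφ hφc => ?_
  let Φ : 𝓓((⊤ : TopologicalSpace.Opens (PhaseSpace L)), ℝ) := ⟨φ, hφ, hφc, by simp⟩
  have e2 := hgint Φ (Set.subset_univ _)
  simp only [smul_eq_mul]
  calc ∫ x, φ x * F x = u Φ := (hu Φ).symm
    _ = ∫ x, g x * Φ x := e2
    _ = ∫ x, φ x * g x :=
        integral_congr_ae (ae_of_all _ fun x => by show g x * φ x = φ x * g x; ring)

end Regularity

/-! ## Weak `L¹(μ_T)` solutions are classical smooth solutions -/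

section Classical

variable {ω₂ lam β : ℝ}

/-- **Weak `μ_T`-solutions of `(σ X_H + c S_B) g = f` are (a.e. equal to) classical smooth
solutions.** For `pinnedChain ω₂ lam β γ` (`ω₂ > 0`, `lam, β ≥ 0`), `L ≥ 1`, `T > 0`, `σ ≠ 0`,
`c > 0`, site weights `B ≥ 0` with `B_0 > 0`, constant `κ`: if `g ∈ L¹(μ_T)` satisfies
`∫ (−σ X_H φ + c S_B φ + κ φ) g dμ_T = ∫ f φ dμ_T` for all `φ ∈ C_c^∞` (`f` smooth;
`−σ X_H + c S_B + κ` is the `μ_T`-adjoint of `σ X_H + c S_B + κ`), then `g` agrees `μ_T`-a.e. with a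
smooth `g'` solving `σ X_H g' + c S_B g' + κ g' = f` POINTWISE (`κ = 0`: Poisson problems; `κ = −λ`:
resolvent equations). Proof: `gρ_T dx` solves the equation in `𝓓′`
(`exists_smooth_ae_eq_of_weak_gen`: Hörmander + brackets), the smooth representative divided by
`ρ_T > 0` is `g'`, and the pointwise equation follows from `integral_genOp_mul_eq_adjoint` and the
fundamental lemma of the calculus of variations. [folklore] -/
theorem exists_classical_of_weak_gibbs (hω : 0 < ω₂) (hl : 0 ≤ lam) (hβ : 0 ≤ β) (γ : ℝ) {L : ℕ}
    (hL : 0 < L) {T : ℝ} (hT : 0 < T) {σ c : ℝ} (hσ : σ ≠ 0) (hc : 0 < c) {B : Fin L → ℝ}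
    (hB : ∀ i, 0 ≤ B i) (hB0 : 0 < B ⟨0, hL⟩) (κ : ℝ) {g : PhaseSpace L → ℝ}
    (hg : Integrable g ((pinnedChain ω₂ lam β γ).gibbsMeasure L T)) {f : PhaseSpace L → ℝ}
    (hf : ContDiff ℝ ∞ f)
    (hweak : ∀ φ : PhaseSpace L → ℝ, ContDiff ℝ ∞ φ → HasCompactSupport φ →
      ∫ x, (-σ * liouvilleOp (pinnedChain ω₂ lam β γ) L φ x + c * bathOp L B T φ x + κ * φ x) *
          g x ∂((pinnedChain ω₂ lam β γ).gibbsMeasure L T) =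
        ∫ x, f x * φ x ∂((pinnedChain ω₂ lam β γ).gibbsMeasure L T)) :
    ∃ g' : PhaseSpace L → ℝ, ContDiff ℝ ∞ g' ∧
      g =ᵐ[(pinnedChain ω₂ lam β γ).gibbsMeasure L T] g' ∧
      ∀ x, σ * liouvilleOp (pinnedChain ω₂ lam β γ) L g' x + c * bathOp L B T g' x + κ * g' x =
        f x := by
  set P := pinnedChain ω₂ lam β γ with hP
  have hU1 : ContDiff ℝ 1 P.U := pinnedChain_contDiff_U ω₂ lam β γ
  have hV1 : ContDiff ℝ 1 P.V := pinnedChain_contDiff_V ω₂ lam β γ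
  have hHs : ContDiff ℝ ∞ (P.hamiltonian L) :=
    P.contDiff_hamiltonian (pinnedChain_contDiff_U ω₂ lam β γ) (pinnedChain_contDiff_V ω₂ lam β γ) L
  have hρs : ContDiff ℝ ∞ (P.gibbsDensity L T) := Real.contDiff_exp.comp (hHs.neg.div_const T)
  have hρpos : ∀ x, 0 < P.gibbsDensity L T x := fun x => P.gibbsDensity_pos L T x
  have hρint : Integrable (P.gibbsDensity L T) := pinnedChain_integrable_gibbsDensity hω hl hβ γ L hT
  have hcTB : ∀ i, 0 ≤ c * T * B i := fun i => mul_nonneg (mul_nonneg hc.le hT.le) (hB i)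
  have hcTB0 : 0 < c * T * B ⟨0, hL⟩ := mul_pos (mul_pos hc hT) hB0
  -- pass to Lebesgue measure: F = g ρ
  have hFint : Integrable (fun x => g x * P.gibbsDensity L T x) := by
    have h1 := hg
    rw [OscillatorChain.gibbsMeasure_eq, integrable_tilted_iff hρint] at h1
    refine h1.congr (ae_of_all _ fun x => ?_)
    simp only [smul_eq_mul, OscillatorChain.exp_neg_hamiltonian_div]
    ring
  have hFweak : ∀ φ : PhaseSpace L → ℝ, ContDiff ℝ ∞ φ → HasCompactSupport φ →
      ∫ x, (-σ * liouvilleOp P L φ x + c * bathOp L B T φ x + κ * φ x) *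
          (g x * P.gibbsDensity L T x) =
        ∫ x, (f x * P.gibbsDensity L T x) * φ x := by
    intro φ hφ hφc
    have e := hweak φ hφ hφc
    rw [P.integral_gibbsMeasure, P.integral_gibbsMeasure] at e
    have hZ : (∫ x, P.gibbsDensity L T x)⁻¹ ≠ 0 := inv_ne_zero (integral_exp_pos hρint).ne'
    have e2 := mul_left_cancel₀ hZ e
    have l1 : (fun x => (-σ * liouvilleOp P L φ x + c * bathOp L B T φ x + κ * φ x) * g x *
          P.gibbsDensity L T x) =
        fun x => (-σ * liouvilleOp P L φ x + c * bathOp L B T φ x + κ * φ x) *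
          (g x * P.gibbsDensity L T x) :=
      funext fun x => by ring
    have l2 : (fun x => f x * φ x * P.gibbsDensity L T x) =
        fun x => (f x * P.gibbsDensity L T x) * φ x := funext fun x => by ring
    rw [l1, l2] at e2
    exact e2
  obtain ⟨G, hG, hFG⟩ := exists_smooth_ae_eq_of_weak_gen hβ γ hL hσ hcTB hcTB0 κ
    hFint.locallyIntegrable (hf.mul hρs) hFweak
  -- the smooth representative
  set g' : PhaseSpace L → ℝ := fun x => G x / P.gibbsDensity L T x with hg'
  have hg'C : ContDiff ℝ ∞ g' := hG.div hρs fun x => (hρpos x).ne'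
  have hg'2 : ContDiff ℝ 2 g' := hg'C.of_le (by norm_cast)
  have hg'1 : ContDiff ℝ 1 g' := hg'C.of_le (by norm_cast)
  have hae : g =ᵐ[volume] g' := by
    filter_upwards [hFG] with x hx
    rw [hg', eq_div_iff (hρpos x).ne']
    exact hx
  have haeμ : g =ᵐ[P.gibbsMeasure L T] g' := (P.gibbsMeasure_absolutelyContinuous L T).ae_eq hae
  refine ⟨g', hg'C, haeμ, ?_⟩
  -- the classical equation
  have hAc : Continuous (fun x => σ * liouvilleOp P L g' x + c * bathOp L B T g' x + κ * g' x) :=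
    ((continuous_const.mul (continuous_liouvilleOp P hU1 hV1 hg'1)).add
      (continuous_const.mul (continuous_bathOp hg'2 _ _))).add (continuous_const.mul hg'C.continuous)
  have hRc : Continuous (fun x => (σ * liouvilleOp P L g' x + c * bathOp L B T g' x + κ * g' x -
      f x) * P.gibbsDensity L T x) :=
    (hAc.sub hf.continuous).mul hρs.continuous
  have hR : ∀ φ : PhaseSpace L → ℝ, ContDiff ℝ ∞ φ → HasCompactSupport φ →
      ∫ x, φ x • ((σ * liouvilleOp P L g' x + c * bathOp L B T g' x + κ * g' x - f x) *
        P.gibbsDensity L T x) = 0 := by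
    intro φ hφ hφc
    have hφ2 : ContDiff ℝ 2 φ := hφ.of_le (by norm_cast)
    -- adjointness with `−σ` in place of `σ`
    have hadj := integral_genOp_mul_eq_adjoint P hU1 hV1 L hT.ne' (-σ) c B κ hφ2 hφc hg'2
    simp only [neg_neg] at hadj
    -- the weak equation on the smooth representative
    have e1 : (fun x => (-σ * liouvilleOp P L φ x + c * bathOp L B T φ x + κ * φ x) *
        (g' x * P.gibbsDensity L T x)) =ᵐ[volume]
        fun x => (-σ * liouvilleOp P L φ x + c * bathOp L B T φ x + κ * φ x) *
          (g x * P.gibbsDensity L T x) := by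
      filter_upwards [hae] with x hx
      rw [hx]
    have e2 : ∫ x, φ x * ((σ * liouvilleOp P L g' x + c * bathOp L B T g' x + κ * g' x) *
        P.gibbsDensity L T x) = ∫ x, (f x * P.gibbsDensity L T x) * φ x := by
      rw [← hadj, integral_congr_ae e1]
      exact hFweak φ hφ hφc
    -- subtract
    have i1 : Integrable (fun x => φ x * ((σ * liouvilleOp P L g' x + c * bathOp L B T g' x +
        κ * g' x) * P.gibbsDensity L T x)) :=
      Continuous.integrable_of_hasCompactSupport (hφ.continuous.mul (hAc.mul hρs.continuous))
        hφc.mul_right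
    have i2 : Integrable (fun x => (f x * P.gibbsDensity L T x) * φ x) :=
      Continuous.integrable_of_hasCompactSupport ((hf.continuous.mul hρs.continuous).mul
        hφ.continuous) hφc.mul_left
    have e3 : ∫ x, (φ x * ((σ * liouvilleOp P L g' x + c * bathOp L B T g' x + κ * g' x) *
        P.gibbsDensity L T x) - (f x * P.gibbsDensity L T x) * φ x) = 0 := by
      rw [integral_sub i1 i2, e2, sub_self]
    rw [← e3]
    refine integral_congr_ae (ae_of_all _ fun x => ?_)
    simp only [smul_eq_mul]
    ring
  have hR0 := ae_eq_zero_of_integral_contDiff_smul_eq_zero hRc.locallyIntegrable hR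
  have hRzero := (Continuous.ae_eq_iff_eq volume hRc continuous_const).mp hR0
  intro x
  have hx := congr_fun hRzero x
  simp only [mul_eq_zero, (hρpos x).ne', or_false] at hx
  linarith

end Classical

/-! ## The device: forward fields from weak `L²(μ_T)` solutions -/

section Device

variable {ω₂ lam β : ℝ}

/-- **Reduction of `stub_deviceForwardFields` to weak solvability.** For the γ-probed device
(`pinnedChain ω₂ lam β γ`, `ω₂ > 0`, `lam, β ≥ 0`, `γ, T > 0`, `N + M ≥ 1`) and a terminal (or any)
site `s`: every mean-zero `g ∈ L²(μ_T)` solving `L_dev g = −(p_s² − T)` WEAKLY — i.e.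
`∫ (−X_H φ + γ S_{deviceWeight} φ) g dμ_T = −∫ (p_s² − T) φ dμ_T` for all `φ ∈ C_c^∞`, the
equation tested against the `μ_T`-adjoint `L_dev^† = −X_H + γ S_B` — agrees `μ_T`-a.e. with a
classical forward field: a `C²` (indeed smooth), `L²(μ_T)`, mean-zero `g'` with
`deviceGenerator … (fun _ => T) g' = −(kin s − T)` pointwise (the four clauses of the line's
`deviceForwardFields … s`). So the existence stub is EXACTLY the existence of a weak `L²(μ_T)`
solution (e.g. `g = ∫₀^∞ P_t (p_s² − T) dt` once the device semigroup converges exponentially in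
an `L²(μ_T)`-dominated norm, CEHR 2018 Thm 2.13 (3) for the four-thermostat network).
[folklore] -/
theorem deviceForwardField_of_weak (hω : 0 < ω₂) (hl : 0 ≤ lam) (hβ : 0 ≤ β) {γ : ℝ} (hγ : 0 < γ)
    {T : ℝ} (hT : 0 < T) {N M : ℕ} (hNM : 0 < N + M) (s : ℕ) {g : PhaseSpace (N + M) → ℝ}
    (hL2 : MemLp g 2 ((pinnedChain ω₂ lam β γ).gibbsMeasure (N + M) T))
    (hmean : ∫ x, g x ∂((pinnedChain ω₂ lam β γ).gibbsMeasure (N + M) T) = 0)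
    (hweak : ∀ φ : PhaseSpace (N + M) → ℝ, ContDiff ℝ ∞ φ → HasCompactSupport φ →
      ∫ x, (-liouvilleOp (pinnedChain ω₂ lam β γ) (N + M) φ x +
          γ * bathOp (N + M) (deviceWeight N M) T φ x) * g x
          ∂((pinnedChain ω₂ lam β γ).gibbsMeasure (N + M) T) =
        ∫ x, -(kin (N + M) s x - T) * φ x ∂((pinnedChain ω₂ lam β γ).gibbsMeasure (N + M) T)) :
    ∃ g' : PhaseSpace (N + M) → ℝ,
      (ContDiff ℝ 2 g' ∧ MemLp g' 2 ((pinnedChain ω₂ lam β γ).gibbsMeasure (N + M) T) ∧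
        ∫ x, g' x ∂((pinnedChain ω₂ lam β γ).gibbsMeasure (N + M) T) = 0 ∧
        ∀ x, deviceGenerator (pinnedChain ω₂ lam β γ) N M (fun _ => T) g' x =
          -(kin (N + M) s x - T)) ∧
      g =ᵐ[(pinnedChain ω₂ lam β γ).gibbsMeasure (N + M) T] g' := by
  have hB : ∀ i, 0 ≤ deviceWeight N M i := fun i => by
    unfold deviceWeight OscillatorChain.bathWeight
    split_ifs <;> norm_num
  have hB0 : 0 < deviceWeight N M ⟨0, hNM⟩ := by
    unfold deviceWeight OscillatorChain.bathWeight
    simp only [if_true]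
    split_ifs <;> norm_num
  have hkin : ContDiff ℝ ∞ (fun x : PhaseSpace (N + M) => -(kin (N + M) s x - T)) := by
    unfold kin
    refine (ContDiff.sub (ContDiff.sum fun i _ => ?_) contDiff_const).neg
    split_ifs
    · exact ((contDiff_apply ℝ ℝ i).comp contDiff_snd).pow 2
    · exact contDiff_const
  have hweak' : ∀ φ : PhaseSpace (N + M) → ℝ, ContDiff ℝ ∞ φ → HasCompactSupport φ →
      ∫ x, (-1 * liouvilleOp (pinnedChain ω₂ lam β γ) (N + M) φ x +
          γ * bathOp (N + M) (deviceWeight N M) T φ x + 0 * φ x) * g x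
          ∂((pinnedChain ω₂ lam β γ).gibbsMeasure (N + M) T) =
        ∫ x, (fun y => -(kin (N + M) s y - T)) x * φ x
          ∂((pinnedChain ω₂ lam β γ).gibbsMeasure (N + M) T) := by
    intro φ hφ hφc
    simpa only [neg_one_mul, zero_mul, add_zero] using hweak φ hφ hφc
  haveI := pinnedChain_isProbabilityMeasure_gibbsMeasure hω hl hβ γ (N + M) hT
  obtain ⟨g', hg'C, hae, hpde⟩ := exists_classical_of_weak_gibbs hω hl hβ γ hNM hT one_ne_zero hγ
    hB hB0 0 (hL2.integrable one_le_two) hkin hweak'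
  refine ⟨g', ⟨hg'C.of_le (by norm_cast), hL2.ae_eq hae, ?_, fun x => ?_⟩, hae⟩
  · rw [← integral_congr_ae hae]
    exact hmean
  · rw [deviceGenerator_eq]
    have e := hpde x
    rw [one_mul, zero_mul, add_zero] at e
    exact e


/-- **The same reduction for the PLAIN chain** (`B = bathWeight`, generator `L_{T,T}`; for the
sister stub `stub_plainForwardField`, any site `s`, in particular `s = 0`): a mean-zero weak
`L²(μ_T)` solution of `L_{T,T} g = −(p_s² − T)` — `∫ (−X_H φ + γ S_{bathWeight} φ) g dμ_T =
−∫ (p_s² − T) φ dμ_T` for all `φ ∈ C_c^∞` — agrees `μ_T`-a.e. with a classical one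
(`C²`, `L²(μ_T)`, mean zero, `generator L T T g' = −(kin s − T)` pointwise). [folklore] -/
theorem plainForwardField_of_weak (hω : 0 < ω₂) (hl : 0 ≤ lam) (hβ : 0 ≤ β) {γ : ℝ} (hγ : 0 < γ)
    {T : ℝ} (hT : 0 < T) {L : ℕ} (hL : 0 < L) (s : ℕ) {g : PhaseSpace L → ℝ}
    (hL2 : MemLp g 2 ((pinnedChain ω₂ lam β γ).gibbsMeasure L T))
    (hmean : ∫ x, g x ∂((pinnedChain ω₂ lam β γ).gibbsMeasure L T) = 0)
    (hweak : ∀ φ : PhaseSpace L → ℝ, ContDiff ℝ ∞ φ → HasCompactSupport φ →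
      ∫ x, (-liouvilleOp (pinnedChain ω₂ lam β γ) L φ x +
          γ * bathOp L (OscillatorChain.bathWeight L) T φ x) * g x
          ∂((pinnedChain ω₂ lam β γ).gibbsMeasure L T) =
        ∫ x, -(kin L s x - T) * φ x ∂((pinnedChain ω₂ lam β γ).gibbsMeasure L T)) :
    ∃ g' : PhaseSpace L → ℝ,
      (ContDiff ℝ 2 g' ∧ MemLp g' 2 ((pinnedChain ω₂ lam β γ).gibbsMeasure L T) ∧
        ∫ x, g' x ∂((pinnedChain ω₂ lam β γ).gibbsMeasure L T) = 0 ∧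
        ∀ x, (pinnedChain ω₂ lam β γ).generator L T T g' x = -(kin L s x - T)) ∧
      g =ᵐ[(pinnedChain ω₂ lam β γ).gibbsMeasure L T] g' := by
  have hB : ∀ i, 0 ≤ OscillatorChain.bathWeight L i := fun i => by
    unfold OscillatorChain.bathWeight
    split_ifs <;> norm_num
  have hB0 : 0 < OscillatorChain.bathWeight L ⟨0, hL⟩ := by
    unfold OscillatorChain.bathWeight
    simp only [if_true]
    split_ifs <;> norm_num
  have hkin : ContDiff ℝ ∞ (fun x : PhaseSpace L => -(kin L s x - T)) := by
    unfold kin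
    refine (ContDiff.sub (ContDiff.sum fun i _ => ?_) contDiff_const).neg
    split_ifs
    · exact ((contDiff_apply ℝ ℝ i).comp contDiff_snd).pow 2
    · exact contDiff_const
  have hweak' : ∀ φ : PhaseSpace L → ℝ, ContDiff ℝ ∞ φ → HasCompactSupport φ →
      ∫ x, (-1 * liouvilleOp (pinnedChain ω₂ lam β γ) L φ x +
          γ * bathOp L (OscillatorChain.bathWeight L) T φ x + 0 * φ x) * g x
          ∂((pinnedChain ω₂ lam β γ).gibbsMeasure L T) =
        ∫ x, (fun y => -(kin L s y - T)) x * φ x ∂((pinnedChain ω₂ lam β γ).gibbsMeasure L T) := by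
    intro φ hφ hφc
    simpa only [neg_one_mul, zero_mul, add_zero] using hweak φ hφ hφc
  haveI := pinnedChain_isProbabilityMeasure_gibbsMeasure hω hl hβ γ L hT
  obtain ⟨g', hg'C, hae, hpde⟩ := exists_classical_of_weak_gibbs hω hl hβ γ hL hT one_ne_zero hγ
    hB hB0 0 (hL2.integrable one_le_two) hkin hweak'
  refine ⟨g', ⟨hg'C.of_le (by norm_cast), hL2.ae_eq hae, ?_, fun x => ?_⟩, hae⟩
  · rw [← integral_congr_ae hae]
    exact hmean
  · rw [generator_eq_liouvilleOp_add]
    have e := hpde x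
    rw [one_mul, zero_mul, add_zero] at e
    exact e

end Device

/-- Registered helper sub-goal `helper_dffForwardFieldOfWeak` of stub `stub_deviceForwardFields`: weak `L²(μ_T)` solutions are classical device forward fields (= `deviceForwardField_of_weak` in stub form). [folklore] -/
theorem helper_dffForwardFieldOfWeak : ∀ (ω₂ lam β γ : ℝ), 0 < ω₂ → 0 ≤ lam → 0 ≤ β → 0 < γ → ∀ (T : ℝ), 0 < T → ∀ (N M : ℕ), 0 < N + M → ∀ (s : ℕ) (g : PhaseSpace (N + M) → ℝ), MemLp g 2 ((pinnedChain ω₂ lam β γ).gibbsMeasure (N + M) T) → ∫ x, g x ∂((pinnedChain ω₂ lam β γ).gibbsMeasure (N + M) T) = 0 → (∀ φ : PhaseSpace (N + M) → ℝ, ContDiff ℝ ∞ φ → HasCompactSupport φ → ∫ x, (-Summit.AtomisticToContinuum.FouriersLaw.Theorems.SuperadditiveResistance.DeviceLiouville.liouvilleOp (pinnedChain ω₂ lam β γ) (N + M) φ x + γ * Summit.AtomisticToContinuum.FouriersLaw.Theorems.SuperadditiveResistance.DeviceLiouville.bathOp (N + M) (Summit.AtomisticToContinuum.FouriersLaw.Theorems.SuperadditiveResistance.DeviceLiouville.deviceWeight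 N M) T φ x) * g x ∂((pinnedChain ω₂ lam β γ).gibbsMeasure (N + M) T) = ∫ x, -(kin (N + M) s x - T) * φ x ∂((pinnedChain ω₂ lam β γ).gibbsMeasure (N + M) T)) → ∃ g' : PhaseSpace (N + M) → ℝ, (ContDiff ℝ 2 g' ∧ MemLp g' 2 ((pinnedChain ω₂ lam β γ).gibbsMeasure (N + M) T) ∧ ∫ x, g' x ∂((pinnedChain ω₂ lam β γ).gibbsMeasure (N + M) T) = 0 ∧ ∀ x, deviceGenerator (pinnedChain ω₂ lam β γ) N M (fun _ => T) g' x = -(kin (N + M) s x - T)) ∧ g =ᵐ[(pinnedChain ω₂ lam β γ).gibbsMeasure (N + M) T] g' :=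
  fun _ _ _ _ hω hl hβ hγ _ hT _ _ hNM s _ hL2 hmean hweak => deviceForwardField_of_weak hω hl hβ hγ hT hNM s hL2 hmean hweak

end Summit.AtomisticToContinuum.FouriersLaw.Cruxes.SuperadditiveResistance.FloatingProbeBypassLaplacian

end
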